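import Literature.MathematicalPhysics.QuantumFieldTheory.Balaban1983to89.B8Eq151V2Divergence
import Literature.MathematicalPhysics.QuantumFieldTheory.Balaban1983to89.B8SectDSource

/-!
# `Balaban1983to89.B8LambdaSpaceKLevel` — T. Bałaban, *Spaces of regular gauge field configurations on a lattice and gauge fixing
# conditions*, Commun. Math. Phys. **99** (1985) 75–102 [Balaban1985RegularSpaces] ("B8"), Sect. D p. 93: THE DOMAIN (1.102)
# «{λ : |λ| < βα₄, |Dλ| < βα₄(Lʲη)⁻¹ on Ω_j, j = 0, 1, …, k−1}, or simply {λ : |λ|, |Dλ|₍₋₁₎ < βα₄}» AS A COMPLEX BANACH SPACE AT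
# `k` LEVELS (level-dependent weights `Lʲη`), and the contraction sentence of p. 94 («the transformation 𝔉 maps the domain (1.102) with
# β = ¼ into itself and is contractive … there exists a unique fixed point») ON IT, in the pointwise «on Ω_j» currency of the lineage

statement-level skeleton of published theorems with citation tags; proofs where landed; nothing here is a claim about the
Yang–Mills mass gap

PDF held: `paper:balaban1985-cmp99-regular-spaces-gauge-fixing` (journal page = PDF page + 74); pp. 91–94 [PDF 17–20] read on the text
layer by this seat (2026-08-26).

WHAT IS PRINTED (p. 93 [PDF 19], verbatim where legible).  *"One of the results of [4], Theorem 3.1, tells us that G′ is a bounded operator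
from a space with the norm |·|₍₋₂₎ into a space with the norm |·| for functions, and the norm |·|₍₋₁₎ for their first derivatives. Thus
we have |𝔉(λ)| ≤ B′₀B₁(α₀+α₁) + B′₀C′₄B₁(α₀+α₁)α₄, |D𝔉(λ)| ≤ (B′₀B₁(α₀+α₁) + B′₀C′₄B₁(α₀+α₁)α₄)(Lʲη)⁻¹ on Ω_j, (1.101) if λ belongs to the
space {λ : |λ| < βα₄, |Dλ| < βα₄(Lʲη)⁻¹ on Ω_j, j = 0, 1, …, k−1}, β ≤ ½, or simply {λ : |λ|, |Dλ|₍₋₁₎ < βα₄}. (1.102)"*; p. 94 [PDF 20]: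
*"Thus the transformation 𝔉 maps the domain (1.102) with β = ¼ into itself and is contractive if the inequality (1.103) holds with
β = ¼. The contraction mapping theorem implies that there exists a unique fixed point of this transformation in the considered domain."*;
p. 86 [PDF 12]: *"|A|₍α₎ = sup_j sup_{Ω_j} (Lʲη)^{−α}|A|"* (the norms of [4] (3.40)–(3.41)); (1.1) p. 76: *"(D^η_{U,μ}F)(x) =
η⁻¹(R(U(x, x + ηe_μ))F(x + ηe_μ) − F(x))"*.

WHY THIS FILE (cell `pub-ymgap`, HUMAN RULING D-0062, dag-lead REBALANCE №41-b; seat `pub-ymgap-dag-n19-b` g2, free hand on the CUT-3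
«hP5 at k levels from letters» of `pub-ymgap-dag-n05-a`).  The tree has the λ-space of Sect. E ONE-LEVEL (`B8Eq1119LambdaSpace`, r05: the
closed graph subspace `{(λ, w·D_{U₀}λ)}` with ONE weight `w = Lᵏ`) and Proposition 5's contraction ABSTRACTLY (`B8SectDSource` §1/§4,
`B8Prop5Repaired`).  The provider of the Theorem-4 socket `hP5` (`B8Thm4InductionLocal.thm4_exists_all_levels`) needs print's ACTUAL domain
(1.102): the modulus `max{|λ|, |Dλ|₍₋₁₎}` with the LEVEL-DEPENDENT weights `Lʲη` on the bonds of `Ω_j`, `j ≤ k` — this file (definition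
lane) — and the p. 94 contraction sentence on that space with the bounds (1.98)R/(1.99)/(1.101)/(1.106) entering in the POINTWISE
«on Ω_j» currency of the k-level files of `pub-ymgap-dag-n05-b` (`B8DprimeKLevelLipschitz`, `B8SectEKLevelDomainSeq`).  The CONCRETE
nonlinearity of (1.100) (𝔉₄ via (1.86)–(1.89), D′ of Sect. E, the Neumann inversion (1.96)) is the sibling `B8Prop5ContractionKLevel`
(kernel lane); the step «fixed point ⇒ (1.107)» is `pub-ymgap-dag-n04-b`'s (REBALANCE №41-a) over `B8Eq195Linear`.

WHAT IS TYPED / PROVED HERE (0 sorry; definitions with bodies + kernel-checked API; no theorem of the paper is asserted).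
* §1 **`lamSubK η U₀ L k Eb`** — THE SPACE (1.102): the CLOSED GRAPH SUBSPACE of the sup-normed bounded `𝔸`-valued functions on
  `ℤᵈ ⊕ (ℕ × ℤᵈ × {directions})` consisting of the tuples `(λ, ((Lʲη)·(D^η_{U₀,κ}λ)(x) on the bonds (x,κ) ∈ Eb j, j ≤ k; 0 elsewhere))`,
  `Eb j` an ARBITRARY family of bond sets («the bonds of Ω_j»: instantiate with `B8Ineq132.BondTouches (Ω j)` or `B8Eq140Level.SideTouches`);
  its norm IS print's modulus `max{ sup_x |λ(x)| , sup_{j ≤ k} sup_{(x,κ) ∈ Eb j} (Lʲη)|(D^η_{U₀,κ}λ)(x)| } = max{|λ|, |Dλ|₍₋₁₎}`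
  (`norm_le_iff`); `isClosed_lamSubK`, `instCompleteSpaceLamSubK` (a complex Banach space — p. 93: «we consider configurations λ with
  values in the complexified algebra»).
* §2 `lamOf` (the λ-component), `norm_lamOf_le`, `weight_mul_norm_covDerivFwd_le` (the two printed members from the norm — the second
  is LITERALLY the socket's `((L:ℝ)^j*η) * ‖covDerivFwd η U₀ b.2 lam b.1‖ ≤ ·`), `mkLam` / `lamOf_mkLam` / `norm_mkLam_le` (writing a λ with
  the two pointwise bounds into the space), `ext_of_lamOf`, `norm_le_iff`, `lamOf_sub` etc.; §2b the REAL configurations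
  `saSet` (self-adjoint-valued λ's: a closed subset containing `0`).
* §3 **`fixedPoint_kLevel`** — p. 94's contraction sentence AT `k` LEVELS, POINTWISE CURRENCY: for ANY maps `Gp` (the letter G′) and `Ψ`
  (the nonlinearity `R(D*A + 𝔉₄(·))` of (1.100), cut wherever the instantiator likes) with (1.101)-shape bounds for `Gp` from (−2)-weighted
  bounds of its argument on `Ω_j` (`hG`, `hGsub`), a (−2)-weighted sup bound `M` of `Ψ` on the closed ¼α₄-ball (`hΨ0` = (1.98)R + (1.99))
  and a (−2)-weighted Lipschitz bound `K` there (`hΨ1` = (1.106)), and the two smallness conditions `B′₀M ≤ ¼α₄` ((1.103), β = ¼),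
  `B′₀K ≤ ½` (p. 94 l. 9): **there is exactly one `s` in the closed ¼α₄-ball with `λ_s = Gp (Ψ λ_s)`**; `norm_fixedPoint_kLevel_le`
  (`‖s‖ ≤ B′₀M` — the a-posteriori bound behind (1.108)); `fixedPoint_kLevel_selfAdjoint` (the fixed point is REAL when `Gp ∘ Ψ` preserves
  real configurations — r05's `B8SectDSource.fixedPoint_mem_of_invariant`).

READINGS / HONEST SCOPE.  (a) CLOSED-ball reading of (1.102) (as r05 `B8SectDSource`, DIVERGENCE D-b08-g4.1): the fixed point is sought in
`‖s‖ ≤ ¼α₄`; the Lipschitz bound is a HYPOTHESIS on the closed ¼-ball (print derives it on the open ¼-domain from (1.99) on the ½-domain by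
the Cauchy formula (1.104)–(1.106) — that derivation is `B8SectDSource.lipschitz_of_norm_le`, to be used by the instantiator).  (b) |λ| is
read with `sup` over ALL sites of `ℤᵈ` (as r05's one-level space; print's λ lives on Ω₀ ⊂ T_η), |Dλ|₍₋₁₎ over the given bond sets only;
accordingly the letter bound `hG` asks `|G′f| ≤ B′₀m` at every site and the gradient member on `Eb j` (the form of n05-b's `hH0`/`hH1`).
(c) `η > 0` explicit (the socket's currency); n05-b's Sect.-E files carry the unnormalised difference `R(U₀(b))λ(b₊) − λ(b₋) = η·(D^ηλ)(b)`
with weight `L^{−j}` — the same member (`B8Eq151V2Divergence.eta_smul_covDerivFwd`, `norm_cjDiff_lamOf_le`).  (d) Nothing of [4] (G′, its bound B′₀) or of (1.99) is proved here: they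
are the displayed hypotheses of §3.  Count-neutral; N05 is NOT discharged by this file; nothing continuum / ℝ⁴ / OS / mass-gap / Clay.
Unit `pub-ymgap-dag-n19-b` (g2), 2026-08-26.  Tree API by name only (`B8Ineq132.covDerivFwd`, `B7Eq78Linearization.conjR`,
`B8Eq151V2Divergence.{eta_smul_covDerivFwd, covDerivFwd_smul}`, `B8SectDSource.{fixedPoint_closedBall, fixedPoint_mem_of_invariant}`), nothing restated.
-/

noncomputable section

open NormedSpace Metric Set
open scoped BoundedContinuousFunction

namespace Literature.MathematicalPhysics.QuantumFieldTheory.Balaban1983to89.B8LambdaSpaceKLevel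

open B7Prop1Explicit
open B7Eq78Linearization (conjR conjR_apply conjR_add conjR_sub conjR_smul)
open B8Ineq132 (covDerivFwd)
open B8Eq151V2Divergence (eta_smul_covDerivFwd covDerivFwd_smul)
open B8SectDSource (fixedPoint_closedBall fixedPoint_mem_of_invariant)

-- `Site` alone could resolve to the torus sites of `Setup.lean`; re-export the `ℤ^d` sites of `B7Prop1Explicit`.
export B7Prop1Explicit (Site)

variable {d : ℕ}

/-! ## §1 The domain (1.102) as a Banach space: the λ's with print's modulus `max{|λ|, |Dλ|₍₋₁₎}` at `k` levels -/

section Space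

variable {𝔸 : Type*} [NormedRing 𝔸] [NormedAlgebra ℂ 𝔸]

variable (d) in
/-- The index set `ℤᵈ ⊕ (levels × ℤᵈ × {directions})` carrying a λ (sites) and its weighted covariant differences `(Lʲη)·D^η_{U₀}λ`
(level `j`, bond `⟨x, x + ηe_κ⟩`). [cite: Balaban1985RegularSpaces, (1.102) p.93 (the two members |λ| and |Dλ|₍₋₁₎)] -/
abbrev PairIdxK : Type := Site d ⊕ (ℕ × Site d × Fin d)

variable (d) in
/-- The ambient Banach space: bounded `𝔸`-valued functions on `PairIdxK d` with the sup norm.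
[cite: Balaban1985RegularSpaces, (1.102) p.93] -/
abbrev PSpaceK (𝔸 : Type*) [NormedRing 𝔸] : Type _ := BoundedContinuousFunction (PairIdxK d) 𝔸

/-- The scale `Lʲη` of level `j` (p. 86: the weight of `|·|₍₋₁₎` on `Ω_j`). [cite: Balaban1985RegularSpaces, p.86 (after (1.55))] -/
def wt (L : ℕ) (η : ℝ) (j : ℕ) : ℝ := (L : ℝ) ^ j * η

/-- `Lʲη ≥ 0` for `η ≥ 0`. [cite: Balaban1985RegularSpaces, p.86 (after (1.55))] -/
theorem wt_nonneg (L : ℕ) {η : ℝ} (hη : 0 ≤ η) (j : ℕ) : 0 ≤ wt L η j := by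
  unfold wt; positivity

/-- `Lʲη > 0` for `L ≥ 1`, `η > 0`. [cite: Balaban1985RegularSpaces, p.86 (after (1.55))] -/
theorem wt_pos {L : ℕ} (hL : 1 ≤ L) {η : ℝ} (hη : 0 < η) (j : ℕ) : 0 < wt L η j := by
  have : (0 : ℝ) < L := by exact_mod_cast hL
  unfold wt; positivity

/-- `‖(Lʲη : ℂ)‖ = Lʲη` for `η ≥ 0`. [cite: Balaban1985RegularSpaces, p.86 (after (1.55))] -/
theorem norm_wt_complex (L : ℕ) {η : ℝ} (hη : 0 ≤ η) (j : ℕ) : ‖((wt L η j : ℝ) : ℂ)‖ = wt L η j := by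
  rw [Complex.norm_real, Real.norm_of_nonneg (wt_nonneg L hη j)]

/-- `D^η_{U₀,κ}` is additive in the function. [cite: Balaban1985RegularSpaces, (1.1) p.76] -/
theorem covDerivFwd_add' (η : ℝ) (U₀ : Site d → Fin d → 𝔸ˣ) (κ : Fin d) (f g : Site d → 𝔸) (x : Site d) :
    covDerivFwd η U₀ κ (f + g) x = covDerivFwd η U₀ κ f x + covDerivFwd η U₀ κ g x := by
  simp only [covDerivFwd, Pi.add_apply, conjR_add, ← smul_add]
  congr 1; abel

/-- `D^η_{U₀,κ} 0 = 0`. [cite: Balaban1985RegularSpaces, (1.1) p.76] -/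
theorem covDerivFwd_zero' (η : ℝ) (U₀ : Site d → Fin d → 𝔸ˣ) (κ : Fin d) (x : Site d) :
    covDerivFwd η U₀ κ (0 : Site d → 𝔸) x = 0 := by
  simp [covDerivFwd, conjR_apply]

/-- `D^η_{U₀,κ}` of a difference. [cite: Balaban1985RegularSpaces, (1.1) p.76] -/
theorem covDerivFwd_sub' (η : ℝ) (U₀ : Site d → Fin d → 𝔸ˣ) (κ : Fin d) (f g : Site d → 𝔸) (x : Site d) :
    covDerivFwd η U₀ κ (f - g) x = covDerivFwd η U₀ κ f x - covDerivFwd η U₀ κ g x := by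
  simp only [covDerivFwd, Pi.sub_apply, conjR_sub, ← smul_sub]
  congr 1; abel

/-- `D^η_{U₀,κ}` of a negative. [cite: Balaban1985RegularSpaces, (1.1) p.76] -/
theorem covDerivFwd_neg' (η : ℝ) (U₀ : Site d → Fin d → 𝔸ˣ) (κ : Fin d) (f : Site d → 𝔸) (x : Site d) :
    covDerivFwd η U₀ κ (-f) x = -covDerivFwd η U₀ κ f x := by
  have h := covDerivFwd_sub' η U₀ κ 0 f x
  rwa [zero_sub, covDerivFwd_zero', zero_sub] at h

open Classical in
/-- The weighted-gradient component of a λ at the index `(j, x, κ)`: `(Lʲη)·(D^η_{U₀,κ}λ)(x)` if `j ≤ k` and `⟨x, x + ηe_κ⟩` is a bond of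
`Ω_j` (`(x, κ) ∈ Eb j`), and `0` otherwise. [cite: Balaban1985RegularSpaces, (1.102) p.93, p.86 (|·|₍₋₁₎)] -/
def gradK (η : ℝ) (U₀ : Site d → Fin d → 𝔸ˣ) (L k : ℕ) (Eb : ℕ → Set (Site d × Fin d)) (lam : Site d → 𝔸)
    (p : ℕ × Site d × Fin d) : 𝔸 :=
  if p.1 ≤ k ∧ (p.2.1, p.2.2) ∈ Eb p.1 then ((wt L η p.1 : ℝ) : ℂ) • covDerivFwd η U₀ p.2.2 lam p.2.1 else 0

/-- The weighted gradient at an index inside the bond sets. [cite: Balaban1985RegularSpaces, (1.102) p.93] -/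
theorem gradK_of_mem {η : ℝ} {U₀ : Site d → Fin d → 𝔸ˣ} {L k : ℕ} {Eb : ℕ → Set (Site d × Fin d)} (lam : Site d → 𝔸)
    {j : ℕ} {x : Site d} {κ : Fin d} (hj : j ≤ k) (hb : (x, κ) ∈ Eb j) :
    gradK η U₀ L k Eb lam (j, x, κ) = ((wt L η j : ℝ) : ℂ) • covDerivFwd η U₀ κ lam x := by
  simp [gradK, hj, hb]

/-- The weighted gradient at an index outside the bond sets is `0`. [cite: Balaban1985RegularSpaces, (1.102) p.93] -/
theorem gradK_of_not {η : ℝ} {U₀ : Site d → Fin d → 𝔸ˣ} {L k : ℕ} {Eb : ℕ → Set (Site d × Fin d)} (lam : Site d → 𝔸)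
    {p : ℕ × Site d × Fin d} (h : ¬ (p.1 ≤ k ∧ (p.2.1, p.2.2) ∈ Eb p.1)) :
    gradK η U₀ L k Eb lam p = 0 := by
  simp [gradK, h]

/-- The weighted gradient is additive in λ. [cite: Balaban1985RegularSpaces, (1.102) p.93] -/
theorem gradK_add (η : ℝ) (U₀ : Site d → Fin d → 𝔸ˣ) (L k : ℕ) (Eb : ℕ → Set (Site d × Fin d)) (f g : Site d → 𝔸)
    (p : ℕ × Site d × Fin d) : gradK η U₀ L k Eb (f + g) p = gradK η U₀ L k Eb f p + gradK η U₀ L k Eb g p := by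
  by_cases h : p.1 ≤ k ∧ (p.2.1, p.2.2) ∈ Eb p.1
  · simp only [gradK, if_pos h, covDerivFwd_add', smul_add]
  · simp only [gradK, if_neg h, add_zero]

/-- The weighted gradient commutes with complex scalars. [cite: Balaban1985RegularSpaces, (1.102) p.93] -/
theorem gradK_smul (η : ℝ) (U₀ : Site d → Fin d → 𝔸ˣ) (L k : ℕ) (Eb : ℕ → Set (Site d × Fin d)) (c : ℂ) (f : Site d → 𝔸)
    (p : ℕ × Site d × Fin d) : gradK η U₀ L k Eb (c • f) p = c • gradK η U₀ L k Eb f p := by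
  by_cases h : p.1 ≤ k ∧ (p.2.1, p.2.2) ∈ Eb p.1
  · simp only [gradK, if_pos h, covDerivFwd_smul]
    rw [smul_comm]
  · simp only [gradK, if_neg h, smul_zero]

/-- The weighted gradient of `0` is `0`. [cite: Balaban1985RegularSpaces, (1.102) p.93] -/
theorem gradK_zero (η : ℝ) (U₀ : Site d → Fin d → 𝔸ˣ) (L k : ℕ) (Eb : ℕ → Set (Site d × Fin d)) (p : ℕ × Site d × Fin d) :
    gradK η U₀ L k Eb (0 : Site d → 𝔸) p = 0 := by
  by_cases h : p.1 ≤ k ∧ (p.2.1, p.2.2) ∈ Eb p.1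
  · simp only [gradK, if_pos h, covDerivFwd_zero', smul_zero]
  · simp only [gradK, if_neg h]

/-- The weighted gradient of a difference. [cite: Balaban1985RegularSpaces, (1.102) p.93] -/
theorem gradK_sub (η : ℝ) (U₀ : Site d → Fin d → 𝔸ˣ) (L k : ℕ) (Eb : ℕ → Set (Site d × Fin d)) (f g : Site d → 𝔸)
    (p : ℕ × Site d × Fin d) : gradK η U₀ L k Eb (f - g) p = gradK η U₀ L k Eb f p - gradK η U₀ L k Eb g p := by
  by_cases h : p.1 ≤ k ∧ (p.2.1, p.2.2) ∈ Eb p.1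
  · simp only [gradK, if_pos h, covDerivFwd_sub', smul_sub]
  · simp only [gradK, if_neg h, sub_zero]

/-- The norm of the weighted gradient at an admissible index is `(Lʲη)·|(D^η_{U₀,κ}λ)(x)|` (`η ≥ 0`).
[cite: Balaban1985RegularSpaces, (1.102) p.93, p.86] -/
theorem norm_gradK_of_mem {η : ℝ} (hη : 0 ≤ η) {U₀ : Site d → Fin d → 𝔸ˣ} {L k : ℕ} {Eb : ℕ → Set (Site d × Fin d)}
    (lam : Site d → 𝔸) {j : ℕ} {x : Site d} {κ : Fin d} (hj : j ≤ k) (hb : (x, κ) ∈ Eb j) :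
    ‖gradK η U₀ L k Eb lam (j, x, κ)‖ = wt L η j * ‖covDerivFwd η U₀ κ lam x‖ := by
  rw [gradK_of_mem lam hj hb, norm_smul, norm_wt_complex L hη]

/-- **THE SPACE (1.102)** for a background `U₀`, spacing `η`, block size `L`, `k` levels and bond sets `Eb j` («the bonds of Ω_j»): the
CLOSED GRAPH SUBSPACE of the sup-normed bounded functions on `ℤᵈ ⊕ (ℕ × ℤᵈ × {directions})` consisting of the tuples
`(λ, (Lʲη)·D^η_{U₀}λ on Eb j (j ≤ k), 0 elsewhere)`; its norm is print's modulus `max{|λ|, |Dλ|₍₋₁₎}`, so the domains (1.102) «|λ| < βα₄,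
|Dλ| < βα₄(Lʲη)⁻¹ on Ω_j» are its norm balls of radius `βα₄`. [cite: Balaban1985RegularSpaces, (1.102) p.93; (1.108) p.94 («|λ|, |Dλ|₍₋₁₎»)] -/
def lamSubK (η : ℝ) (U₀ : Site d → Fin d → 𝔸ˣ) (L k : ℕ) (Eb : ℕ → Set (Site d × Fin d)) : Submodule ℂ (PSpaceK d 𝔸) where
  carrier := {s | ∀ p : ℕ × Site d × Fin d, s (Sum.inr p) = gradK η U₀ L k Eb (fun x => s (Sum.inl x)) p}
  add_mem' := by
    intro s t hs ht p
    simp only [Set.mem_setOf_eq] at hs ht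
    have h := gradK_add η U₀ L k Eb (fun x => s (Sum.inl x)) (fun x => t (Sum.inl x)) p
    simp only [BoundedContinuousFunction.coe_add, Pi.add_apply, hs p, ht p]
    rw [← h]; rfl
  zero_mem' := by
    intro p
    simp only [BoundedContinuousFunction.coe_zero, Pi.zero_apply]
    exact (gradK_zero η U₀ L k Eb p).symm
  smul_mem' := by
    intro c s hs p
    simp only [Set.mem_setOf_eq] at hs
    have h := gradK_smul η U₀ L k Eb c (fun x => s (Sum.inl x)) p
    simp only [BoundedContinuousFunction.coe_smul, hs p]
    rw [← h]; rfl

/-- Membership in the space, unfolded. [cite: Balaban1985RegularSpaces, (1.102) p.93] -/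
theorem mem_lamSubK {η : ℝ} {U₀ : Site d → Fin d → 𝔸ˣ} {L k : ℕ} {Eb : ℕ → Set (Site d × Fin d)} {s : PSpaceK d 𝔸} :
    s ∈ lamSubK η U₀ L k Eb ↔ ∀ p : ℕ × Site d × Fin d, s (Sum.inr p) = gradK η U₀ L k Eb (fun x => s (Sum.inl x)) p :=
  Iff.rfl

/-- The space (1.102) is CLOSED in the sup norm (each defining equation compares continuous functions of `s`: evaluations, a conjugation,
a scalar). [cite: Balaban1985RegularSpaces, (1.102) p.93] -/
theorem isClosed_lamSubK (η : ℝ) (U₀ : Site d → Fin d → 𝔸ˣ) (L k : ℕ) (Eb : ℕ → Set (Site d × Fin d)) :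
    IsClosed ((lamSubK η U₀ L k Eb : Submodule ℂ (PSpaceK d 𝔸)) : Set (PSpaceK d 𝔸)) := by
  have : ((lamSubK η U₀ L k Eb : Submodule ℂ (PSpaceK d 𝔸)) : Set (PSpaceK d 𝔸)) =
      ⋂ (p : ℕ × Site d × Fin d), {s : PSpaceK d 𝔸 | s (Sum.inr p) = gradK η U₀ L k Eb (fun x => s (Sum.inl x)) p} := by
    ext s
    simp only [SetLike.mem_coe, mem_lamSubK, Set.mem_iInter, Set.mem_setOf_eq]
  rw [this]
  refine isClosed_iInter fun p => ?_
  refine isClosed_eq (ContinuousEvalConst.continuous_eval_const _) ?_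
  by_cases h : p.1 ≤ k ∧ (p.2.1, p.2.2) ∈ Eb p.1
  · simp only [gradK, if_pos h, covDerivFwd]
    have h1 : Continuous fun s : PSpaceK d 𝔸 => s (Sum.inl (p.2.1 + e p.2.2)) := ContinuousEvalConst.continuous_eval_const _
    have h2 : Continuous fun s : PSpaceK d 𝔸 => s (Sum.inl p.2.1) := ContinuousEvalConst.continuous_eval_const _
    have h3 : Continuous fun s : PSpaceK d 𝔸 => conjR (U₀ p.2.1 p.2.2) (s (Sum.inl (p.2.1 + e p.2.2))) := by
      simp only [conjR_apply]
      exact (continuous_const.mul h1).mul continuous_const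
    exact ((h3.sub h2).const_smul _).const_smul _
  · simp only [gradK, if_neg h]
    exact continuous_const

variable [CompleteSpace 𝔸]

/-- The space (1.102) is a (complex) Banach space. [cite: Balaban1985RegularSpaces, (1.102) p.93, p.93 («complexified algebra»)] -/
instance instCompleteSpaceLamSubK (η : ℝ) (U₀ : Site d → Fin d → 𝔸ˣ) (L k : ℕ) (Eb : ℕ → Set (Site d × Fin d)) :
    CompleteSpace (lamSubK η U₀ L k Eb : Submodule ℂ (PSpaceK d 𝔸)) :=
  (isClosed_lamSubK η U₀ L k Eb).completeSpace_coe

end Space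

/-! ## §2 Reading a λ off the space, writing a λ into it; the norm as print's two members -/

section Carrier

variable {𝔸 : Type*} [NormedRing 𝔸] [NormedAlgebra ℂ 𝔸]
variable {η : ℝ} {U₀ : Site d → Fin d → 𝔸ˣ} {L k : ℕ} {Eb : ℕ → Set (Site d × Fin d)}

/-- The λ-component of an element of the space: `λ(x) = s(inl x)`. [cite: Balaban1985RegularSpaces, (1.102) p.93] -/
def lamOf (s : lamSubK η U₀ L k Eb) : Site d → 𝔸 :=
  fun x => (s : PSpaceK d 𝔸) (Sum.inl x)

/-- `lamOf` of a difference. [cite: Balaban1985RegularSpaces, (1.102) p.93] -/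
theorem lamOf_sub (s t : lamSubK η U₀ L k Eb) : lamOf (s - t) = lamOf s - lamOf t := by
  funext x; simp [lamOf]

/-- `lamOf` of a sum. [cite: Balaban1985RegularSpaces, (1.102) p.93] -/
theorem lamOf_add (s t : lamSubK η U₀ L k Eb) : lamOf (s + t) = lamOf s + lamOf t := by
  funext x; simp [lamOf]

/-- `lamOf` of a scalar multiple. [cite: Balaban1985RegularSpaces, (1.102) p.93] -/
theorem lamOf_smul (c : ℂ) (s : lamSubK η U₀ L k Eb) : lamOf (c • s) = c • lamOf s := by
  funext x; simp [lamOf]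

/-- `lamOf 0 = 0`. [cite: Balaban1985RegularSpaces, (1.102) p.93] -/
theorem lamOf_zero : lamOf (0 : lamSubK η U₀ L k Eb) = 0 := by
  funext x; simp [lamOf]

/-- `lamOf` of a negative. [cite: Balaban1985RegularSpaces, (1.102) p.93] -/
theorem lamOf_neg (s : lamSubK η U₀ L k Eb) : lamOf (-s) = -lamOf s := by
  funext x; simp [lamOf]

/-- The gradient components of an element are the weighted gradients of its λ-component.
[cite: Balaban1985RegularSpaces, (1.102) p.93] -/
theorem apply_inr (s : lamSubK η U₀ L k Eb) (p : ℕ × Site d × Fin d) :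
    (s : PSpaceK d 𝔸) (Sum.inr p) = gradK η U₀ L k Eb (lamOf s) p :=
  (mem_lamSubK.mp s.2) p

/-- **The |λ|-member of (1.102) from the norm**: `‖λ(x)‖ ≤ ‖s‖` at every site. [cite: Balaban1985RegularSpaces, (1.102) p.93] -/
theorem norm_lamOf_le (s : lamSubK η U₀ L k Eb) (x : Site d) : ‖lamOf s x‖ ≤ ‖s‖ := by
  rw [Submodule.coe_norm]
  exact BoundedContinuousFunction.norm_coe_le_norm (s : PSpaceK d 𝔸) (Sum.inl x)

/-- **The |Dλ|₍₋₁₎-member of (1.102) from the norm**, in the socket's currency: `(Lʲη)·‖(D^η_{U₀,κ}λ)(x)‖ ≤ ‖s‖` on every bond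
`(x, κ) ∈ Eb j`, `j ≤ k` (`η ≥ 0`). [cite: Balaban1985RegularSpaces, (1.102) p.93; (1.108) p.94] -/
theorem weight_mul_norm_covDerivFwd_le (hη : 0 ≤ η) (s : lamSubK η U₀ L k Eb) {j : ℕ} (hj : j ≤ k) {x : Site d} {κ : Fin d}
    (hb : (x, κ) ∈ Eb j) : wt L η j * ‖covDerivFwd η U₀ κ (lamOf s) x‖ ≤ ‖s‖ := by
  have hle : ‖(s : PSpaceK d 𝔸) (Sum.inr (j, x, κ))‖ ≤ ‖s‖ := by
    rw [Submodule.coe_norm]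
    exact BoundedContinuousFunction.norm_coe_le_norm (s : PSpaceK d 𝔸) (Sum.inr (j, x, κ))
  rwa [apply_inr, norm_gradK_of_mem hη (lamOf s) hj hb] at hle

/-- The same in print's pointwise form `‖(D^η_{U₀,κ}λ)(x)‖ ≤ ‖s‖·(Lʲη)⁻¹` (`L ≥ 1`, `η > 0`). [cite: Balaban1985RegularSpaces, (1.102) p.93] -/
theorem norm_covDerivFwd_lamOf_le (hL : 1 ≤ L) (hη : 0 < η) (s : lamSubK η U₀ L k Eb) {j : ℕ} (hj : j ≤ k) {x : Site d} {κ : Fin d}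
    (hb : (x, κ) ∈ Eb j) : ‖covDerivFwd η U₀ κ (lamOf s) x‖ ≤ ‖s‖ * (wt L η j)⁻¹ := by
  have h := weight_mul_norm_covDerivFwd_le hη.le s hj hb
  rw [le_mul_inv_iff₀ (wt_pos hL hη j), mul_comm]
  exact h

/-- The same in n05-b's Sect.-E currency `‖R(U₀(b))λ(b₊) − λ(b₋)‖ ≤ ‖s‖·(Lʲ)⁻¹` (`L ≥ 1`, `η > 0`; the `η` cancels).
[cite: Balaban1985RegularSpaces, (1.102) p.93, (1.1) p.76] -/
theorem norm_cjDiff_lamOf_le (hL : 1 ≤ L) (hη : 0 < η) (s : lamSubK η U₀ L k Eb) {j : ℕ} (hj : j ≤ k) {x : Site d} {κ : Fin d}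
    (hb : (x, κ) ∈ Eb j) : ‖conjR (U₀ x κ) (lamOf s (x + e κ)) - lamOf s x‖ ≤ ‖s‖ * ((L : ℝ) ^ j)⁻¹ := by
  have h := weight_mul_norm_covDerivFwd_le hη.le s hj hb
  rw [← eta_smul_covDerivFwd hη.ne' U₀ κ (lamOf s) x, norm_smul, Real.norm_of_nonneg hη.le]
  have hLj : (0 : ℝ) < (L : ℝ) ^ j := by
    have : (0 : ℝ) < L := by exact_mod_cast hL
    positivity
  rw [le_mul_inv_iff₀ hLj]
  calc η * ‖covDerivFwd η U₀ κ (lamOf s) x‖ * (L : ℝ) ^ j = wt L η j * ‖covDerivFwd η U₀ κ (lamOf s) x‖ := by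
        unfold wt; ring
    _ ≤ ‖s‖ := h

/-- The tuple `(λ, weighted gradients)` of a plain λ. [cite: Balaban1985RegularSpaces, (1.102) p.93] -/
def pairFunK (η : ℝ) (U₀ : Site d → Fin d → 𝔸ˣ) (L k : ℕ) (Eb : ℕ → Set (Site d × Fin d)) (lam : Site d → 𝔸) : PairIdxK d → 𝔸
  | Sum.inl x => lam x
  | Sum.inr p => gradK η U₀ L k Eb lam p

/-- The tuple of a λ with the two pointwise bounds is bounded by `max{a, b}` (`η ≥ 0`).
[cite: Balaban1985RegularSpaces, (1.102) p.93] -/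
theorem norm_pairFunK_le (hη : 0 ≤ η) {lam : Site d → 𝔸} {a b : ℝ} (ha : ∀ x, ‖lam x‖ ≤ a)
    (hb : ∀ j, j ≤ k → ∀ p ∈ Eb j, wt L η j * ‖covDerivFwd η U₀ p.2 lam p.1‖ ≤ b) (i : PairIdxK d) :
    ‖pairFunK η U₀ L k Eb lam i‖ ≤ max a b := by
  have ha0 : 0 ≤ a := (norm_nonneg _).trans (ha 0)
  cases i with
  | inl x => exact (ha x).trans (le_max_left _ _)
  | inr p =>
    obtain ⟨j, x, κ⟩ := p
    simp only [pairFunK]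
    by_cases h : j ≤ k ∧ (x, κ) ∈ Eb j
    · rw [norm_gradK_of_mem hη lam h.1 h.2]
      exact (hb j h.1 (x, κ) h.2).trans (le_max_right _ _)
    · rw [gradK_of_not lam (by simpa using h), norm_zero]
      exact ha0.trans (le_max_left _ _)

/-- **Writing a λ with bounded modulus into the space (1.102)** (the element `(λ, (Lʲη)·D^η_{U₀}λ)`), from the two printed members:
`|λ| ≤ a` everywhere and `(Lʲη)|D^η_{U₀}λ| ≤ b` on the bonds of `Ω_j`, `j ≤ k`. [cite: Balaban1985RegularSpaces, (1.102) p.93] -/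
def mkLam (hη : 0 ≤ η) (lam : Site d → 𝔸) {a b : ℝ} (ha : ∀ x, ‖lam x‖ ≤ a)
    (hb : ∀ j, j ≤ k → ∀ p ∈ Eb j, wt L η j * ‖covDerivFwd η U₀ p.2 lam p.1‖ ≤ b) : lamSubK η U₀ L k Eb :=
  ⟨BoundedContinuousFunction.ofNormedAddCommGroupDiscrete (pairFunK η U₀ L k Eb lam) (max a b) (norm_pairFunK_le hη ha hb), by
    rw [mem_lamSubK]
    intro p
    rfl⟩

/-- `lamOf (mkLam λ) = λ`. [cite: Balaban1985RegularSpaces, (1.102) p.93] -/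
@[simp] theorem lamOf_mkLam (hη : 0 ≤ η) (lam : Site d → 𝔸) {a b : ℝ} (ha : ∀ x, ‖lam x‖ ≤ a)
    (hb : ∀ j, j ≤ k → ∀ p ∈ Eb j, wt L η j * ‖covDerivFwd η U₀ p.2 lam p.1‖ ≤ b) :
    lamOf (mkLam (U₀ := U₀) (L := L) (Eb := Eb) hη lam ha hb) = lam := by
  funext x; rfl

/-- `‖mkLam λ‖ ≤ max{a, b}`. [cite: Balaban1985RegularSpaces, (1.102) p.93] -/
theorem norm_mkLam_le (hη : 0 ≤ η) (lam : Site d → 𝔸) {a b : ℝ} (ha : ∀ x, ‖lam x‖ ≤ a)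
    (hb : ∀ j, j ≤ k → ∀ p ∈ Eb j, wt L η j * ‖covDerivFwd η U₀ p.2 lam p.1‖ ≤ b) :
    ‖mkLam (U₀ := U₀) (L := L) (Eb := Eb) hη lam ha hb‖ ≤ max a b := by
  have ha0 : 0 ≤ a := (norm_nonneg _).trans (ha 0)
  rw [Submodule.coe_norm]
  refine (BoundedContinuousFunction.norm_le (ha0.trans (le_max_left _ _))).2 fun i => ?_
  exact norm_pairFunK_le hη ha hb i

/-- An element of the space is determined by its λ-component. [cite: Balaban1985RegularSpaces, (1.102) p.93] -/
theorem ext_of_lamOf {s t : lamSubK η U₀ L k Eb} (h : lamOf s = lamOf t) : s = t := by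
  apply Subtype.ext
  ext i
  cases i with
  | inl x => exact congrFun h x
  | inr p => rw [apply_inr, apply_inr, h]

/-- **THE NORM IS PRINT'S MODULUS `max{|λ|, |Dλ|₍₋₁₎}`**: `‖s‖ ≤ C` iff `|λ| ≤ C` at every site and `(Lʲη)|D^η_{U₀}λ| ≤ C` on every bond of
`Ω_j`, `j ≤ k` (`C ≥ 0`, `η ≥ 0`). [cite: Balaban1985RegularSpaces, (1.102) p.93 («or simply {λ : |λ|, |Dλ|₍₋₁₎ < βα₄}»), p.86] -/
theorem norm_le_iff (hη : 0 ≤ η) (s : lamSubK η U₀ L k Eb) {C : ℝ} (hC : 0 ≤ C) :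
    ‖s‖ ≤ C ↔ (∀ x, ‖lamOf s x‖ ≤ C) ∧ ∀ j, j ≤ k → ∀ p ∈ Eb j, wt L η j * ‖covDerivFwd η U₀ p.2 (lamOf s) p.1‖ ≤ C := by
  constructor
  · intro h
    exact ⟨fun x => (norm_lamOf_le s x).trans h, fun j hj p hp => (weight_mul_norm_covDerivFwd_le hη s hj hp).trans h⟩
  · rintro ⟨ha, hb⟩
    rw [Submodule.coe_norm]
    refine (BoundedContinuousFunction.norm_le hC).2 fun i => ?_
    cases i with
    | inl x => exact ha x
    | inr p =>
      obtain ⟨j, x, κ⟩ := p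
      rw [apply_inr]
      by_cases h : j ≤ k ∧ (x, κ) ∈ Eb j
      · rw [norm_gradK_of_mem hη (lamOf s) h.1 h.2]
        exact hb j h.1 (x, κ) h.2
      · rw [gradK_of_not (lamOf s) (by simpa using h), norm_zero]
        exact hC

/-- The distance of two elements is the modulus of the difference of their λ-components: `‖s − t‖ ≤ C` iff `|λ_s − λ_t| ≤ C` and
`(Lʲη)|D^η_{U₀}(λ_s − λ_t)| ≤ C` on the bonds (the `r` of (1.105)). [cite: Balaban1985RegularSpaces, (1.105)–(1.106) p.94] -/
theorem norm_sub_le_iff (hη : 0 ≤ η) (s t : lamSubK η U₀ L k Eb) {C : ℝ} (hC : 0 ≤ C) :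
    ‖s - t‖ ≤ C ↔ (∀ x, ‖lamOf s x - lamOf t x‖ ≤ C) ∧
      ∀ j, j ≤ k → ∀ p ∈ Eb j, wt L η j * ‖covDerivFwd η U₀ p.2 (lamOf s - lamOf t) p.1‖ ≤ C := by
  rw [norm_le_iff hη (s - t) hC, lamOf_sub]
  simp only [Pi.sub_apply]

end Carrier

/-! ## §2b The real configurations: self-adjoint-valued λ's form a closed subset containing `0`

p. 93: «The function 𝔉 is obviously an analytic function in λ and we consider configurations λ with values in the complexified algebra.»
The solution of (1.100) must nevertheless be a REAL configuration (so that `u′ = e^{iλ}` is unitary); it is, as soon as the fixed-point map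
preserves real configurations (r05 `B8SectDSource.fixedPoint_mem_of_invariant`). -/

section Real

variable {𝔸 : Type*} [NormedRing 𝔸] [NormedAlgebra ℂ 𝔸] [StarRing 𝔸]
variable {η : ℝ} {U₀ : Site d → Fin d → 𝔸ˣ} {L k : ℕ} {Eb : ℕ → Set (Site d × Fin d)}

variable (η U₀ L k Eb) in
/-- The REAL configurations of the space (1.102): those `s` whose λ-component is self-adjoint at every site.
[cite: Balaban1985RegularSpaces, p.93 (after (1.102))] -/
def saSet : Set (lamSubK η U₀ L k Eb) := {s | ∀ x, IsSelfAdjoint (lamOf s x)}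

/-- Membership in the real configurations, unfolded. [cite: Balaban1985RegularSpaces, p.93 (after (1.102))] -/
theorem mem_saSet {s : lamSubK η U₀ L k Eb} : s ∈ saSet η U₀ L k Eb ↔ ∀ x, IsSelfAdjoint (lamOf s x) := Iff.rfl

/-- `0` is a real configuration. [cite: Balaban1985RegularSpaces, p.93 (after (1.102))] -/
theorem zero_mem_saSet : (0 : lamSubK η U₀ L k Eb) ∈ saSet η U₀ L k Eb := by
  intro x
  rw [lamOf_zero, Pi.zero_apply]
  exact IsSelfAdjoint.zero 𝔸

/-- The real configurations form a CLOSED subset (evaluation and `star` are continuous). [cite: Balaban1985RegularSpaces, p.93 (after (1.102))] -/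
theorem isClosed_saSet [ContinuousStar 𝔸] : IsClosed (saSet η U₀ L k Eb) := by
  have : saSet η U₀ L k Eb = ⋂ x : Site d, {s : lamSubK η U₀ L k Eb | star (lamOf s x) = lamOf s x} := by
    ext s; simp [saSet, IsSelfAdjoint]
  rw [this]
  refine isClosed_iInter fun x => ?_
  have hev : Continuous fun s : lamSubK η U₀ L k Eb => lamOf s x :=
    (ContinuousEvalConst.continuous_eval_const (Sum.inl x)).comp continuous_subtype_val
  exact isClosed_eq hev.star hev

end Real

/-! ## §3 The contraction sentence of p. 94 on the space (1.102), at `k` levels, in the pointwise «on Ω_j» currency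

The fixed-point map of (1.100) is `λ ↦ G′(Ψ λ)` with `Ψ λ = R(D*A + 𝔉₄(λ, Dλ, A, D*A))`.  Here `Gp` and `Ψ` are ARBITRARY maps on plain site
functions; what enters is exactly what print uses: (1.101) = the letter bound of G′ from the (−2)-weighted size of its argument on the `Ω_j`
(`hG`; [4] Thm 3.1, in-edge b9) with G′ additive (`hGsub`), the (−2)-weighted size `M` of `Ψ` on the domain ((1.98)R with (1.99): `hΨ0`) and
its Lipschitz modulus `K` there ((1.106): `hΨ1`), and the smallness (1.103) (β = ¼) / p. 94 l. 9 in the form `B′₀M ≤ ¼α₄`, `B′₀K ≤ ½`. -/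

section Contraction

variable {𝔸 : Type*} [NormedRing 𝔸] [NormedAlgebra ℂ 𝔸]
variable {η : ℝ} {U₀ : Site d → Fin d → 𝔸ˣ} {L k : ℕ} {Eb : ℕ → Set (Site d × Fin d)}

open Classical in
/-- The fixed-point map `𝔉 = G′ ∘ Ψ` of (1.100) as a self-map of the space (1.102): on the closed ¼α₄-ball `s ↦ (G′(Ψλ_s), weighted
gradients)` — an element by the (1.101)-bounds —, and `0` off the ball (never used). [cite: Balaban1985RegularSpaces, (1.100)–(1.101) p.93] -/
def fpMapK (hη : 0 ≤ η) (Ω : ℕ → Set (Site d)) (Gp Ψ : (Site d → 𝔸) → (Site d → 𝔸)) (α₄ B₀' M : ℝ)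
    (hG : ∀ (f : Site d → 𝔸) (m : ℝ), 0 ≤ m → (∀ j, j ≤ k → ∀ x ∈ Ω j, wt L η j ^ 2 * ‖f x‖ ≤ m) →
      (∀ x, ‖Gp f x‖ ≤ B₀' * m) ∧ ∀ j, j ≤ k → ∀ p ∈ Eb j, wt L η j * ‖covDerivFwd η U₀ p.2 (Gp f) p.1‖ ≤ B₀' * m)
    (hM : 0 ≤ M)
    (hΨ0 : ∀ s : lamSubK η U₀ L k Eb, ‖s‖ ≤ α₄ / 4 → ∀ j, j ≤ k → ∀ x ∈ Ω j, wt L η j ^ 2 * ‖Ψ (lamOf s) x‖ ≤ M)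
    (s : lamSubK η U₀ L k Eb) : lamSubK η U₀ L k Eb :=
  if hs : ‖s‖ ≤ α₄ / 4 then
    mkLam hη (Gp (Ψ (lamOf s))) (hG (Ψ (lamOf s)) M hM (hΨ0 s hs)).1 (hG (Ψ (lamOf s)) M hM (hΨ0 s hs)).2
  else 0

/-- On the ball the λ-component of `𝔉 s` is `G′(Ψ λ_s)`. [cite: Balaban1985RegularSpaces, (1.100) p.93] -/
theorem lamOf_fpMapK (hη : 0 ≤ η) (Ω : ℕ → Set (Site d)) (Gp Ψ : (Site d → 𝔸) → (Site d → 𝔸)) (α₄ B₀' M : ℝ)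
    (hG : ∀ (f : Site d → 𝔸) (m : ℝ), 0 ≤ m → (∀ j, j ≤ k → ∀ x ∈ Ω j, wt L η j ^ 2 * ‖f x‖ ≤ m) →
      (∀ x, ‖Gp f x‖ ≤ B₀' * m) ∧ ∀ j, j ≤ k → ∀ p ∈ Eb j, wt L η j * ‖covDerivFwd η U₀ p.2 (Gp f) p.1‖ ≤ B₀' * m)
    (hM : 0 ≤ M)
    (hΨ0 : ∀ s : lamSubK η U₀ L k Eb, ‖s‖ ≤ α₄ / 4 → ∀ j, j ≤ k → ∀ x ∈ Ω j, wt L η j ^ 2 * ‖Ψ (lamOf s) x‖ ≤ M)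
    {s : lamSubK η U₀ L k Eb} (hs : ‖s‖ ≤ α₄ / 4) :
    lamOf (fpMapK hη Ω Gp Ψ α₄ B₀' M hG hM hΨ0 s) = Gp (Ψ (lamOf s)) := by
  rw [fpMapK, dif_pos hs, lamOf_mkLam]

/-- **(1.101) ⇒ «𝔉 maps the domain (1.102) with β = ¼ into itself»**: on the ball, `‖𝔉 s‖ ≤ B′₀M` (hence `≤ ¼α₄` under (1.103)).
[cite: Balaban1985RegularSpaces, (1.101)–(1.103) p.93, p.94] -/
theorem norm_fpMapK_le (hη : 0 ≤ η) (Ω : ℕ → Set (Site d)) (Gp Ψ : (Site d → 𝔸) → (Site d → 𝔸)) (α₄ B₀' M : ℝ)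
    (hG : ∀ (f : Site d → 𝔸) (m : ℝ), 0 ≤ m → (∀ j, j ≤ k → ∀ x ∈ Ω j, wt L η j ^ 2 * ‖f x‖ ≤ m) →
      (∀ x, ‖Gp f x‖ ≤ B₀' * m) ∧ ∀ j, j ≤ k → ∀ p ∈ Eb j, wt L η j * ‖covDerivFwd η U₀ p.2 (Gp f) p.1‖ ≤ B₀' * m)
    (hM : 0 ≤ M)
    (hΨ0 : ∀ s : lamSubK η U₀ L k Eb, ‖s‖ ≤ α₄ / 4 → ∀ j, j ≤ k → ∀ x ∈ Ω j, wt L η j ^ 2 * ‖Ψ (lamOf s) x‖ ≤ M)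
    {s : lamSubK η U₀ L k Eb} (hs : ‖s‖ ≤ α₄ / 4) :
    ‖fpMapK hη Ω Gp Ψ α₄ B₀' M hG hM hΨ0 s‖ ≤ B₀' * M := by
  rw [fpMapK, dif_pos hs]
  exact (norm_mkLam_le hη _ _ _).trans (max_le le_rfl le_rfl)

/-- **The a-posteriori bound behind (1.108)**: every fixed point in the ball has `‖s‖ ≤ B′₀M` (p. 94: «then we have |λ| ≤ 2B′₀B₁(α₀+α₁)» —
`M` instantiates to `B₁(α₀+α₁) + C′₄B₁(α₀+α₁)α₄ ≤ 2B₁(α₀+α₁)`). [cite: Balaban1985RegularSpaces, (1.108) p.94, (1.101) p.93] -/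
theorem norm_fixedPoint_kLevel_le (hη : 0 ≤ η) (Ω : ℕ → Set (Site d)) (Gp Ψ : (Site d → 𝔸) → (Site d → 𝔸)) {α₄ B₀' M : ℝ}
    (hM : 0 ≤ M)
    (hG : ∀ (f : Site d → 𝔸) (m : ℝ), 0 ≤ m → (∀ j, j ≤ k → ∀ x ∈ Ω j, wt L η j ^ 2 * ‖f x‖ ≤ m) →
      (∀ x, ‖Gp f x‖ ≤ B₀' * m) ∧ ∀ j, j ≤ k → ∀ p ∈ Eb j, wt L η j * ‖covDerivFwd η U₀ p.2 (Gp f) p.1‖ ≤ B₀' * m)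
    (hΨ0 : ∀ s : lamSubK η U₀ L k Eb, ‖s‖ ≤ α₄ / 4 → ∀ j, j ≤ k → ∀ x ∈ Ω j, wt L η j ^ 2 * ‖Ψ (lamOf s) x‖ ≤ M)
    {s : lamSubK η U₀ L k Eb} (hs : ‖s‖ ≤ α₄ / 4) (hfix : lamOf s = Gp (Ψ (lamOf s))) : ‖s‖ ≤ B₀' * M := by
  have hB : 0 ≤ B₀' * M := by
    obtain ⟨h0, -⟩ := hG (Ψ (lamOf s)) M hM (hΨ0 s hs)
    exact (norm_nonneg _).trans (h0 0)
  refine (norm_le_iff hη s hB).2 ⟨fun x => ?_, fun j hj p hp => ?_⟩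
  · rw [hfix]; exact (hG (Ψ (lamOf s)) M hM (hΨ0 s hs)).1 x
  · rw [hfix]; exact (hG (Ψ (lamOf s)) M hM (hΨ0 s hs)).2 j hj p hp

variable [CompleteSpace 𝔸]

/-- **THE CONTRACTION SENTENCE OF p. 94 ON THE SPACE (1.102), AT `k` LEVELS** — «the transformation 𝔉 maps the domain (1.102) with β = ¼
into itself and is contractive … The contraction mapping theorem implies that there exists a unique fixed point of this transformation in
the considered domain»: for ANY letter `Gp` (G′) with the (1.101)-shape bound from the (−2)-weighted size of its argument on the `Ω_j`
(`hG`) and additive (`hGsub`), and ANY nonlinearity `Ψ` (= `R(D*A + 𝔉₄(·))`) with (−2)-weighted size `M` on the closed ¼α₄-ball (`hΨ0` =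
(1.98)R + (1.99)) and (−2)-weighted Lipschitz modulus `K` there (`hΨ1` = (1.106)), under `B′₀M ≤ ¼α₄` ((1.103), β = ¼) and `B′₀K ≤ ½`
(p. 94 l. 9): THERE IS EXACTLY ONE `s` with `‖s‖ ≤ ¼α₄` and `λ_s = G′(Ψ λ_s)`.  Nothing of [4] or of (1.99) is proved: they are the
hypotheses. [cite: Balaban1985RegularSpaces, p.94 (after (1.106)), (1.100)–(1.103) p.93, (1.106) p.94] -/
theorem fixedPoint_kLevel (hη : 0 ≤ η) (Ω : ℕ → Set (Site d)) (Gp Ψ : (Site d → 𝔸) → (Site d → 𝔸)) {α₄ B₀' M K : ℝ}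
    (hα₄ : 0 ≤ α₄) (hB : 0 ≤ B₀') (hM : 0 ≤ M) (hK : 0 ≤ K)
    (hG : ∀ (f : Site d → 𝔸) (m : ℝ), 0 ≤ m → (∀ j, j ≤ k → ∀ x ∈ Ω j, wt L η j ^ 2 * ‖f x‖ ≤ m) →
      (∀ x, ‖Gp f x‖ ≤ B₀' * m) ∧ ∀ j, j ≤ k → ∀ p ∈ Eb j, wt L η j * ‖covDerivFwd η U₀ p.2 (Gp f) p.1‖ ≤ B₀' * m)
    (hGsub : ∀ f g : Site d → 𝔸, Gp (f - g) = Gp f - Gp g)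
    (hΨ0 : ∀ s : lamSubK η U₀ L k Eb, ‖s‖ ≤ α₄ / 4 → ∀ j, j ≤ k → ∀ x ∈ Ω j, wt L η j ^ 2 * ‖Ψ (lamOf s) x‖ ≤ M)
    (hΨ1 : ∀ s t : lamSubK η U₀ L k Eb, ‖s‖ ≤ α₄ / 4 → ‖t‖ ≤ α₄ / 4 →
      ∀ j, j ≤ k → ∀ x ∈ Ω j, wt L η j ^ 2 * ‖Ψ (lamOf s) x - Ψ (lamOf t) x‖ ≤ K * ‖s - t‖)
    (h103 : B₀' * M ≤ α₄ / 4) (h106 : B₀' * K ≤ 1 / 2) :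
    ∃! s : lamSubK η U₀ L k Eb, ‖s‖ ≤ α₄ / 4 ∧ lamOf s = Gp (Ψ (lamOf s)) := by
  set T := fpMapK hη Ω Gp Ψ α₄ B₀' M hG hM hΨ0 with hT
  -- self-map of the closed ball
  have hmaps : ∀ s : lamSubK η U₀ L k Eb, ‖s‖ ≤ α₄ / 4 → ‖T s‖ ≤ α₄ / 4 := fun s hs =>
    (norm_fpMapK_le hη Ω Gp Ψ α₄ B₀' M hG hM hΨ0 hs).trans h103
  -- Lipschitz with constant `B′₀K ≤ ½`
  have hlip : ∀ s t : lamSubK η U₀ L k Eb, ‖s‖ ≤ α₄ / 4 → ‖t‖ ≤ α₄ / 4 → ‖T s - T t‖ ≤ B₀' * K * ‖s - t‖ := by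
    intro s t hs ht
    have hm : 0 ≤ K * ‖s - t‖ := by positivity
    have hdiff : ∀ j, j ≤ k → ∀ x ∈ Ω j, wt L η j ^ 2 * ‖(Ψ (lamOf s) - Ψ (lamOf t)) x‖ ≤ K * ‖s - t‖ := fun j hj x hx => by
      simpa only [Pi.sub_apply] using hΨ1 s t hs ht j hj x hx
    obtain ⟨h0, h1⟩ := hG (Ψ (lamOf s) - Ψ (lamOf t)) (K * ‖s - t‖) hm hdiff
    rw [show B₀' * K * ‖s - t‖ = B₀' * (K * ‖s - t‖) by ring]
    refine (norm_sub_le_iff hη (T s) (T t) (by positivity)).2 ⟨fun x => ?_, fun j hj p hp => ?_⟩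
    · rw [hT, lamOf_fpMapK hη Ω Gp Ψ α₄ B₀' M hG hM hΨ0 hs, lamOf_fpMapK hη Ω Gp Ψ α₄ B₀' M hG hM hΨ0 ht, ← Pi.sub_apply,
        ← hGsub]
      exact h0 x
    · rw [hT, lamOf_fpMapK hη Ω Gp Ψ α₄ B₀' M hG hM hΨ0 hs, lamOf_fpMapK hη Ω Gp Ψ α₄ B₀' M hG hM hΨ0 ht, ← hGsub]
      exact h1 j hj p hp
  have hκ1 : B₀' * K < 1 := by linarith
  obtain ⟨s, ⟨hs, hfix⟩, huniq⟩ := fixedPoint_closedBall T (by positivity) (by positivity) hκ1 hmaps hlip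
  refine ⟨s, ⟨hs, ?_⟩, fun t ⟨ht, htfix⟩ => huniq t ⟨ht, ?_⟩⟩
  · have h := congrArg lamOf hfix
    rwa [hT, lamOf_fpMapK hη Ω Gp Ψ α₄ B₀' M hG hM hΨ0 hs, eq_comm] at h
  · apply ext_of_lamOf
    rw [hT, lamOf_fpMapK hη Ω Gp Ψ α₄ B₀' M hG hM hΨ0 ht]
    exact htfix.symm

/-- **The fixed point is a REAL configuration** when `G′ ∘ Ψ` preserves real configurations (p. 93: λ is complexified only for the Cauchy
formula; the solution of (1.100) is real) — r05's `B8SectDSource.fixedPoint_mem_of_invariant` on the closed subset `saSet`.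
[cite: Balaban1985RegularSpaces, p.93 (after (1.102)), (1.100) p.93] -/
theorem fixedPoint_kLevel_selfAdjoint [StarRing 𝔸] [ContinuousStar 𝔸] (hη : 0 ≤ η) (Ω : ℕ → Set (Site d))
    (Gp Ψ : (Site d → 𝔸) → (Site d → 𝔸)) {α₄ B₀' M K : ℝ}
    (hα₄ : 0 ≤ α₄) (hB : 0 ≤ B₀') (hM : 0 ≤ M) (hK : 0 ≤ K)
    (hG : ∀ (f : Site d → 𝔸) (m : ℝ), 0 ≤ m → (∀ j, j ≤ k → ∀ x ∈ Ω j, wt L η j ^ 2 * ‖f x‖ ≤ m) →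
      (∀ x, ‖Gp f x‖ ≤ B₀' * m) ∧ ∀ j, j ≤ k → ∀ p ∈ Eb j, wt L η j * ‖covDerivFwd η U₀ p.2 (Gp f) p.1‖ ≤ B₀' * m)
    (hGsub : ∀ f g : Site d → 𝔸, Gp (f - g) = Gp f - Gp g)
    (hΨ0 : ∀ s : lamSubK η U₀ L k Eb, ‖s‖ ≤ α₄ / 4 → ∀ j, j ≤ k → ∀ x ∈ Ω j, wt L η j ^ 2 * ‖Ψ (lamOf s) x‖ ≤ M)
    (hΨ1 : ∀ s t : lamSubK η U₀ L k Eb, ‖s‖ ≤ α₄ / 4 → ‖t‖ ≤ α₄ / 4 →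
      ∀ j, j ≤ k → ∀ x ∈ Ω j, wt L η j ^ 2 * ‖Ψ (lamOf s) x - Ψ (lamOf t) x‖ ≤ K * ‖s - t‖)
    (h103 : B₀' * M ≤ α₄ / 4) (h106 : B₀' * K ≤ 1 / 2)
    (hreal : ∀ lam : Site d → 𝔸, (∀ x, IsSelfAdjoint (lam x)) → ∀ x, IsSelfAdjoint (Gp (Ψ lam) x))
    {s : lamSubK η U₀ L k Eb} (hs : ‖s‖ ≤ α₄ / 4) (hfix : lamOf s = Gp (Ψ (lamOf s))) :
    ∀ x, IsSelfAdjoint (lamOf s x) := by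
  set T := fpMapK hη Ω Gp Ψ α₄ B₀' M hG hM hΨ0 with hT
  have hmaps : ∀ s : lamSubK η U₀ L k Eb, ‖s‖ ≤ α₄ / 4 → ‖T s‖ ≤ α₄ / 4 := fun s hs =>
    (norm_fpMapK_le hη Ω Gp Ψ α₄ B₀' M hG hM hΨ0 hs).trans h103
  have hlip : ∀ s t : lamSubK η U₀ L k Eb, ‖s‖ ≤ α₄ / 4 → ‖t‖ ≤ α₄ / 4 → ‖T s - T t‖ ≤ B₀' * K * ‖s - t‖ := by
    intro s t hs ht
    have hm : 0 ≤ K * ‖s - t‖ := by positivity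
    have hdiff : ∀ j, j ≤ k → ∀ x ∈ Ω j, wt L η j ^ 2 * ‖(Ψ (lamOf s) - Ψ (lamOf t)) x‖ ≤ K * ‖s - t‖ := fun j hj x hx => by
      simpa only [Pi.sub_apply] using hΨ1 s t hs ht j hj x hx
    obtain ⟨h0, h1⟩ := hG (Ψ (lamOf s) - Ψ (lamOf t)) (K * ‖s - t‖) hm hdiff
    rw [show B₀' * K * ‖s - t‖ = B₀' * (K * ‖s - t‖) by ring]
    refine (norm_sub_le_iff hη (T s) (T t) (by positivity)).2 ⟨fun x => ?_, fun j hj p hp => ?_⟩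
    · rw [hT, lamOf_fpMapK hη Ω Gp Ψ α₄ B₀' M hG hM hΨ0 hs, lamOf_fpMapK hη Ω Gp Ψ α₄ B₀' M hG hM hΨ0 ht, ← Pi.sub_apply,
        ← hGsub]
      exact h0 x
    · rw [hT, lamOf_fpMapK hη Ω Gp Ψ α₄ B₀' M hG hM hΨ0 hs, lamOf_fpMapK hη Ω Gp Ψ α₄ B₀' M hG hM hΨ0 ht, ← hGsub]
      exact h1 j hj p hp
  have hκ1 : B₀' * K < 1 := by linarith
  have hinv : ∀ t ∈ saSet η U₀ L k Eb, ‖t‖ ≤ α₄ / 4 → T t ∈ saSet η U₀ L k Eb := by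
    intro t ht htn x
    rw [hT, lamOf_fpMapK hη Ω Gp Ψ α₄ B₀' M hG hM hΨ0 htn]
    exact hreal (lamOf t) ht x
  have hTfix : T s = s := by
    apply ext_of_lamOf
    rw [hT, lamOf_fpMapK hη Ω Gp Ψ α₄ B₀' M hG hM hΨ0 hs]
    exact hfix.symm
  exact fixedPoint_mem_of_invariant T (by positivity) (by positivity) hκ1 hmaps hlip (saSet η U₀ L k Eb) isClosed_saSet
    zero_mem_saSet hinv hs hTfix

end Contraction

/-! ## §4 Sanity: the space and the contraction sentence are inhabited (trivially) -/

section Sanity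

variable {𝔸 : Type*} [NormedRing 𝔸] [NormedAlgebra ℂ 𝔸] [CompleteSpace 𝔸]

/-- SANITY (non-vacuity of §3's binder list): with `G′ = 0` and `Ψ = 0` every hypothesis holds with `M = K = 0` and the unique fixed point is
`0`. Shows only that the clauses are jointly satisfiable. [cite: Balaban1985RegularSpaces, p.94 (after (1.106))] -/
example (η : ℝ) (hη : 0 ≤ η) (U₀ : Site d → Fin d → 𝔸ˣ) (L k : ℕ) (Eb : ℕ → Set (Site d × Fin d)) (Ω : ℕ → Set (Site d)) :
    ∃! s : lamSubK η U₀ L k Eb, ‖s‖ ≤ (1 : ℝ) / 4 ∧ lamOf s = (fun _ => 0) ((fun _ => 0) (lamOf s)) := by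
  refine fixedPoint_kLevel (η := η) (U₀ := U₀) (L := L) (k := k) (Eb := Eb) hη Ω (fun _ => 0) (fun _ => 0)
    (α₄ := 1) (B₀' := 0) (M := 0) (K := 0) zero_le_one le_rfl le_rfl le_rfl ?_ ?_ ?_ ?_ (by norm_num) (by norm_num)
  · intro f m hm _
    refine ⟨fun x => by simp, fun j hj p hp => ?_⟩
    simp [covDerivFwd, conjR_apply]
  · intro f g; simp
  · intro s _ j _ x _; simp
  · intro s t _ _ j _ x _; simp

end Sanity

#print axioms fixedPoint_kLevel
#print axioms fixedPoint_kLevel_selfAdjoint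

end Literature.MathematicalPhysics.QuantumFieldTheory.Balaban1983to89.B8LambdaSpaceKLevel

end
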